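import Summits.Ventures.LatticeQCDFlow.Scaling.HomStarSharpLaw
import Summits.Ventures.LatticeQCDFlow.Scaling.StarCycleCertificateLaw

/-!
HONEST FRAMING: exact (Metropolis-corrected) sampling algorithms for lattice gauge theory; figures
of merit are autocorrelation/cost numbers at stated couplings and volumes; no continuum-physics
claim.

# HomStarSharpMixing — THE SCHEME-LEVEL SHARP LAW IN CLOSED FORM: THE POOLED LAW OF CHAPTER U's HOMOGENEOUS REPLICA-EXCHANGE STAR IS WITHIN `ε` OF `π_S` AFTER
# `n ≥ (96(c+2K+2)(t+h)/(t·h·p̄))·log((2D(c+2K+2)(t+h)/(t·p̄))/ε)` SCHEME STEPS, `h = (1−t)w_0` — ORDER `(K/(p̄·min{t,h}))·log(K/(p̄·t·ε))` AT EVERY SWAP RATE (lean-2 GEN-44, ours)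

Venture-side (OURS).  Cell `lqcd-flow` (pub-lqcd), unit `pub-lqcd-lean-2-g44`, 2026-08-31.  Chapter AD, file 12 = file 10 read as a step count: `(1 − a)ⁿ ≤ e^{−an}` with
`a = (t+h)(1−β) ≥ t·h·p̄/(96(c+2K+2)(t+h))` (`1 − β = ε'/(1+ε') ≥ ε'/2`, `ε' = (1−σ)σp̄/(48(c+2K+2)) ≤ 1`, `(t+h)σ(1−σ) = th/(t+h)`), then `C·e^{−an} ≤ ε` once `n ≥ (1/a)·log(C/ε)`
(chapter S's `exp_le_of_ge_log`).  Hypotheses: those of file 10, `0 < ε`.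

* **`homStar_sharp_pooled_le`**.

Reading (no numerics implied): `(96(c+2K+2)(t+h)/(t·h·p̄)) = O(K/(p̄·min{t,h}))` at `c = 2K+4` (since `(t+h)/(th) ≤ 2/min{t,h}`), and the logarithm is `log(K³(t+h)/(t·p̄·ε))` — the conjectured
law-free order of OPEN-MATH item 1 (i) for pooled observables of `K` identical replicas behind one persistent hot sampler, at every swap fraction; file 11 is the matching floor.  Literature grade
(cell rule): OWN; nothing cited; no new bib keys.
-/

noncomputable section
open Finset Function
open Literature.Probability.MarkovChains

namespace Summit.Ventures.LatticeQCDFlow.Scaling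

section SharpMixing
variable {S : Type*} [Fintype S] [DecidableEq S] {K m : ℕ} {μ : Fin (K + 1) → S → ℝ} {M : Fin (K + 1) → S → S → ℝ} {w : Fin (K + 1) → ℝ} {t : ℝ}
variable (κ : Fin m → Fin K)
variable {X : Type*} [Fintype X] [DecidableEq X]
variable {hub : X → S} {comp : X → S → ℕ} {W θ : S → ℝ} {p σ c C : ℝ} {acc : S → S → ℝ} {Kh : (S → ℕ) → S → S → ℝ}
variable {Δ : (S → ℕ) → (S → ℕ) → ℕ} {F Ψ : X × X → ℝ}
variable {NCf : X → X → S → ℕ} {af bf : X → X → S} {PXf PYf : X → X → Option S → Option S → ℝ} {xtf ytf xsf ysf : X → X → Option S → ℝ}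
variable {Ast Bst Sst : X → X → ℝ} {g : (S → ℕ) → ℝ} {πS : X → ℝ} {Z : ℝ}
variable {Λ : (Fin (K + 1) → S) → X}

/-- **THE POOLED LAW OF THE HOMOGENEOUS REPLICA-EXCHANGE STAR IS `ε`-CLOSE TO `π_S` AFTER `O((K/(p̄·min{t,h}))·log)` SCHEME STEPS** (see the module docstring). [ours] -/
theorem homStar_sharp_pooled_le [Nonempty X] (hm : 1 ≤ m) (hμ : ∀ k x, 0 < μ k x) (hμsum : ∀ k, ∑ u, μ k u = 1) (hhom : ∀ i : Fin K, μ i.succ = μ 1)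
    (hw0 : ∀ k, 0 ≤ w k) (hw00 : 0 < w 0) (hw1 : ∑ k, w k = 1) (ht0 : 0 < t) (ht1 : t < 1)
    (hM0 : ∀ u v, M 0 u v = μ 0 v) (hidle : ∀ i : Fin K, ∀ u v, M i.succ u v = if v = u then 1 else 0)
    {c' : ℕ} (hunif : ∀ i : Fin K, (univ.filter fun r : Fin m => κ r = i).card = c')
    (hWdef : ∀ v, W v = μ 1 v / μ 0 v) (hinj : ∀ x x', hub x = hub x' → comp x = comp x' → x = x') (hsum : ∀ x, ∑ v, comp x v = K + 1)
    (hsurj : ∀ (z : S) (N : S → ℕ), ∑ v, N v = K + 1 → N z ≠ 0 → ∃ x, hub x = z ∧ comp x = N) (hhub : ∀ x, comp x (hub x) ≠ 0) (hK : 2 ≤ K)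
    (hW : ∀ v, 0 < W v) (hp0 : 0 ≤ p) (hp : ∀ v, p * W v ≤ 1) (hθ : ∀ v, θ v = 1 / (1 + p * W v)) (hacc : ∀ h v, acc h v = min 1 (W h / W v))
    (hc : 2 * (K : ℝ) + 4 ≤ c) (hσ : σ = t / (t + (1 - t) * w 0))
    (hgap : 0 < p * ∑ v, μ 0 v * (W v * θ v))
    (hKoff : ∀ N h v, h ≠ v → Kh N h v = if N h = 0 then 0 else (N v : ℝ) / K * acc h v) (hKdiag : ∀ N h, Kh N h h = 1 - ∑ v ∈ univ.erase h, Kh N h v)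
    (hΔ : ∀ N N', Δ N N' = ∑ v, (N v - N' v))
    (hF : ∀ x y, F (x, y) = c + (-(1 - σ) * θ (hub x)) + (-(1 - σ) * θ (hub y)) + ∑ v, θ v * ((comp x v : ℝ) + (comp y v : ℝ)))
    (hC : C = 2 * ((K + 1) * (c + 2 * K + 6)))
    (hΨ : ∀ x y, Ψ (x, y) = (Δ (comp x) (comp y) : ℝ) * F (x, y) + C * (if hub x = hub y then (0 : ℝ) else 1))
    -- the tagged data of every ORIENTED adjacent pair (as in W23 ∕ X6)
    (horient : ∀ x y, hub x = hub y → Δ (comp x) (comp y) = 1 → W (bf x y) ≤ W (af x y) ∨ W (bf y x) ≤ W (af y x))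
    (hcx : ∀ x y, hub x = hub y → Δ (comp x) (comp y) = 1 → W (bf x y) ≤ W (af x y) → comp x = NCf x y + Pi.single (af x y) 1)
    (hcy : ∀ x y, hub x = hub y → Δ (comp x) (comp y) = 1 → W (bf x y) ≤ W (af x y) → comp y = NCf x y + Pi.single (bf x y) 1)
    (hPXoff : ∀ x y, hub x = hub y → Δ (comp x) (comp y) = 1 → W (bf x y) ≤ W (af x y) →
      ∀ h v, h ≠ v → PXf x y (some h) (some v) = if NCf x y h = 0 then 0 else (NCf x y v : ℝ) / K * acc h v)
    (hPXin : ∀ x y, hub x = hub y → Δ (comp x) (comp y) = 1 → W (bf x y) ≤ W (af x y) →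
      ∀ h, PXf x y (some h) none = if NCf x y h = 0 then 0 else acc h (af x y) / K)
    (hPXdiag : ∀ x y, hub x = hub y → Δ (comp x) (comp y) = 1 → W (bf x y) ≤ W (af x y) →
      ∀ h, PXf x y (some h) (some h) = 1 - (∑ v ∈ univ.erase h, PXf x y (some h) (some v) + PXf x y (some h) none))
    (hPXout : ∀ x y, hub x = hub y → Δ (comp x) (comp y) = 1 → W (bf x y) ≤ W (af x y) → ∀ v, PXf x y none (some v) = (NCf x y v : ℝ) / K * acc (af x y) v)
    (hPXstay : ∀ x y, hub x = hub y → Δ (comp x) (comp y) = 1 → W (bf x y) ≤ W (af x y) → PXf x y none none = 1 - ∑ v, PXf x y none (some v))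
    (hPYoff : ∀ x y, hub x = hub y → Δ (comp x) (comp y) = 1 → W (bf x y) ≤ W (af x y) →
      ∀ h v, h ≠ v → PYf x y (some h) (some v) = if NCf x y h = 0 then 0 else (NCf x y v : ℝ) / K * acc h v)
    (hPYin : ∀ x y, hub x = hub y → Δ (comp x) (comp y) = 1 → W (bf x y) ≤ W (af x y) →
      ∀ h, PYf x y (some h) none = if NCf x y h = 0 then 0 else acc h (bf x y) / K)
    (hPYdiag : ∀ x y, hub x = hub y → Δ (comp x) (comp y) = 1 → W (bf x y) ≤ W (af x y) →
      ∀ h, PYf x y (some h) (some h) = 1 - (∑ v ∈ univ.erase h, PYf x y (some h) (some v) + PYf x y (some h) none))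
    (hPYout : ∀ x y, hub x = hub y → Δ (comp x) (comp y) = 1 → W (bf x y) ≤ W (af x y) → ∀ v, PYf x y none (some v) = (NCf x y v : ℝ) / K * acc (bf x y) v)
    (hPYstay : ∀ x y, hub x = hub y → Δ (comp x) (comp y) = 1 → W (bf x y) ≤ W (af x y) → PYf x y none none = 1 - ∑ v, PYf x y none (some v))
    (hxtf : ∀ x y, hub x = hub y → Δ (comp x) (comp y) = 1 → W (bf x y) ≤ W (af x y) →
      ∀ t, xtf x y t = (1 - σ) * PXf x y (some (hub x)) t + σ * ∑ t', xtf x y t' * PXf x y t' t)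
    (hytf : ∀ x y, hub x = hub y → Δ (comp x) (comp y) = 1 → W (bf x y) ≤ W (af x y) →
      ∀ t, ytf x y t = (1 - σ) * PYf x y (some (hub x)) t + σ * ∑ t', ytf x y t' * PYf x y t' t)
    (hxsf : ∀ x y, hub x = hub y → Δ (comp x) (comp y) = 1 → W (bf x y) ≤ W (af x y) →
      ∀ t, xsf x y t = (1 - σ) * PXf x y none t + σ * ∑ t', xsf x y t' * PXf x y t' t)
    (hysf : ∀ x y, hub x = hub y → Δ (comp x) (comp y) = 1 → W (bf x y) ≤ W (af x y) →
      ∀ t, ysf x y t = (1 - σ) * PYf x y none t + σ * ∑ t', ysf x y t' * PYf x y t' t)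
    -- the step chain of the lumped star (file X5 `LumpedStarStepChain`)
    (hA : ∀ x x', Ast x x' = if comp x' = comp x then Kh (comp x) (hub x) (hub x') else 0)
    (hB : ∀ x x', Bst x x' = μ 0 (hub x') * (if comp x' + Pi.single (hub x) 1 = comp x + Pi.single (hub x') 1 then 1 else 0))
    (hS : ∀ x x', Sst x x' = σ * Ast x x' + (1 - σ) * Bst x x')
    (hg : ∀ N, g N = ∏ v, (μ 0 v * W v) ^ (N v) / ((N v).factorial : ℝ))
    (hZ : Z = ∑ x, g (comp x) * ((comp x (hub x) : ℝ) / W (hub x))) (hπS : ∀ x, πS x = g (comp x) * ((comp x (hub x) : ℝ) / W (hub x)) / Z)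
    (hΛh : ∀ y, hub (Λ y) = y 0) (hΛc : ∀ y v, comp (Λ y) v = (univ.filter fun k : Fin (K + 1) => y k = v).card)
    {ε : ℝ} (hε : 0 < ε) (y : Fin (K + 1) → S) {n : ℕ}
    (hn : 96 * (c + 2 * K + 2) * (t + (1 - t) * w 0) / (t * ((1 - t) * w 0) * (p * ∑ v, μ 0 v * (W v * θ v)))
        * Real.log ((2 * (((K : ℝ) + 1) * (c + 2 * K + 2) + C) * (c + 2 * K + 2) * (t + (1 - t) * w 0) / (t * (p * ∑ v, μ 0 v * (W v * θ v)))) / ε) ≤ n) :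
    tvDist (fun x' => ∑ z ∈ univ.filter (fun z => Λ z = x'),
        lawAt (fun a b => t * ptGraphSwap μ (fun r : Fin m => (((0 : Fin (K + 1)), (κ r).succ) : Fin (K + 1) × Fin (K + 1))) (fun _ : Fin m => Equiv.refl S) a b
          + (1 - t) * prodKernel w M a b) (Pi.single y 1) n z) πS ≤ ε := by
  have h10 := homStar_sharp_tvDist_le κ hm hμ hμsum hhom hw0 hw00 hw1 ht0 ht1 hM0 hidle hunif hWdef hinj hsum hsurj hhub hK hW hp0 hp hθ hacc hc hσ hgap hKoff hKdiag hΔ hF hC hΨ horient hcx hcy hPXoff hPXin hPXdiag hPXout hPXstay hPYoff hPYin hPYdiag hPYout hPYstay hxtf hytf hxsf hysf hA hB hS hg hZ hπS hΛh hΛc y n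
  -- abbreviations
  set pb : ℝ := p * ∑ v, μ 0 v * (W v * θ v) with hpb
  have hK0 : (0 : ℝ) ≤ K := Nat.cast_nonneg _
  have hcK : 0 < c + 2 * K + 2 := by linarith
  have hh0 : 0 < (1 - t) * w 0 := mul_pos (by linarith) hw00
  have hq0 : 0 < t + (1 - t) * w 0 := by linarith
  have hσ0 : 0 < σ := by rw [hσ]; exact div_pos ht0 hq0
  have hσ1 : σ < 1 := by rw [hσ, div_lt_one hq0]; linarith
  have hθm := theta_mem hW hp0 hp hθ
  have hpbar : pb ≤ 1 / 2 := by
    rw [hpb]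
    calc p * ∑ v, μ 0 v * (W v * θ v) = ∑ v, μ 0 v * (p * (W v * θ v)) := by rw [mul_sum]; exact sum_congr rfl fun v _ => by ring
      _ ≤ ∑ v, μ 0 v * (1 / 2) := sum_le_sum fun v _ => mul_le_mul_of_nonneg_left (finiteOdds_pWθ_le_half hp0 hp hW hθ v) (hμ 0 v).le
      _ = 1 / 2 := by rw [← sum_mul, hμsum 0, one_mul]
  -- the rate `a = (t+h)(1−β)` and its floor `a_low = t·h·p̄/(96(c+2K+2)(t+h))`
  set r : ℝ := σ * pb / (c + 2 * K + 2) with hr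
  set ε' : ℝ := (1 - σ) * r / 48 with hε'
  have hr0 : 0 < r := div_pos (mul_pos hσ0 hgap) hcK
  have hε'0 : 0 < ε' := by rw [hε']; exact div_pos (mul_pos (by linarith) hr0) (by norm_num)
  have hε'1 : ε' ≤ 1 := by
    rw [hε', hr]
    have h1 : σ * pb ≤ 1 * (1 / 2) := mul_le_mul hσ1.le hpbar hgap.le zero_le_one
    have h2 : σ * pb / (c + 2 * K + 2) ≤ 1 := by rw [div_le_one hcK]; linarith only [h1, hc, hK0]
    have h3 : 0 ≤ σ * pb / (c + 2 * K + 2) := hr0.le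
    nlinarith only [h2, h3, hσ0, hσ1]
  set a : ℝ := (t + (1 - t) * w 0) * (1 - (1 + ε')⁻¹) with ha
  set alow : ℝ := t * ((1 - t) * w 0) * pb / (96 * (c + 2 * K + 2) * (t + (1 - t) * w 0)) with halow
  have halow0 : 0 < alow := by rw [halow]; exact div_pos (mul_pos (mul_pos ht0 hh0) hgap) (by positivity)
  have h1β : ε' / 2 ≤ 1 - (1 + ε')⁻¹ := by
    rw [show 1 - (1 + ε')⁻¹ = ε' / (1 + ε') by field_simp; ring]
    exact div_le_div_of_nonneg_left hε'0.le (by linarith) (by linarith)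
  have haa : alow ≤ a := by
    rw [ha, halow]
    have hq1' : (t + (1 - t) * w 0) * (ε' / 2) ≤ (t + (1 - t) * w 0) * (1 - (1 + ε')⁻¹) := mul_le_mul_of_nonneg_left h1β hq0.le
    have e : (t + (1 - t) * w 0) * (ε' / 2) = t * ((1 - t) * w 0) * pb / (96 * (c + 2 * K + 2) * (t + (1 - t) * w 0)) := by
      rw [hε', hr, hσ]; field_simp; ring
    linarith
  have ha1 : a ≤ 1 := by
    rw [ha]
    have hw01 : w 0 ≤ 1 := by
      calc w 0 ≤ ∑ k, w k := single_le_sum (fun k _ => hw0 k) (mem_univ 0)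
        _ = 1 := hw1
    have hq1 : t + (1 - t) * w 0 ≤ 1 := by nlinarith [hw0 0]
    have hb1 : 1 - (1 + ε')⁻¹ ≤ 1 := by have := inv_nonneg.mpr (by linarith : (0:ℝ) ≤ 1 + ε'); linarith
    have hb0 : 0 ≤ 1 - (1 + ε')⁻¹ := by linarith
    calc (t + (1 - t) * w 0) * (1 - (1 + ε')⁻¹) ≤ 1 * 1 := mul_le_mul hq1 hb1 hb0 zero_le_one
      _ = 1 := one_mul 1
  -- `(1−a)ⁿ ≤ e^{−a n} ≤ e^{−a_low n}`
  have hpow : (1 - a) ^ n ≤ Real.exp (-alow * n) := by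
    calc (1 - a) ^ n ≤ (Real.exp (-a)) ^ n := pow_le_pow_left₀ (by linarith) (Real.one_sub_le_exp_neg a) n
      _ = Real.exp (-a * n) := by rw [← Real.exp_nat_mul]; ring_nf
      _ ≤ Real.exp (-alow * n) := Real.exp_le_exp.mpr (mul_le_mul_of_nonneg_right (neg_le_neg haa) (Nat.cast_nonneg n))
  -- the constant
  set Cst : ℝ := 2 * (((K : ℝ) + 1) * (c + 2 * K + 2) + C) / r with hCst
  have hD0 : 0 < ((K : ℝ) + 1) * (c + 2 * K + 2) + C := by
    rw [hC]
    have h1 : 0 < ((K : ℝ) + 1) * (c + 2 * K + 2) := mul_pos (by linarith) hcK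
    have h2 : 0 < ((K : ℝ) + 1) * (c + 2 * K + 6) := mul_pos (by linarith) (by linarith)
    linarith only [h1, h2]
  have hCst0 : 0 < Cst := by rw [hCst]; exact div_pos (by linarith) hr0
  -- assemble
  have hmain : Cst * (1 - a) ^ n ≤ ε := by
    calc Cst * (1 - a) ^ n ≤ Cst * Real.exp (-alow * n) := mul_le_mul_of_nonneg_left hpow hCst0.le
      _ ≤ ε := by
          refine exp_le_of_ge_log halow0 hCst0 hε ?_
          have ht' : t ≠ 0 := ht0.ne'
          have hpb' : pb ≠ 0 := hgap.ne'
          have hq' : t + (1 - t) * w 0 ≠ 0 := hq0.ne'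
          have hc' : c + 2 * K + 2 ≠ 0 := hcK.ne'
          have hw' : (1 - t) * w 0 ≠ 0 := hh0.ne'
          have e1 : 1 / alow = 96 * (c + 2 * K + 2) * (t + (1 - t) * w 0) / (t * ((1 - t) * w 0) * pb) := by
            rw [halow, one_div, inv_div]
          have e2 : Cst = 2 * (((K : ℝ) + 1) * (c + 2 * K + 2) + C) * (c + 2 * K + 2) * (t + (1 - t) * w 0) / (t * pb) := by
            rw [hCst, hr, hσ, div_div_eq_mul_div]
            rw [div_eq_div_iff (mul_ne_zero (div_ne_zero ht' hq') hpb') (mul_ne_zero ht' hpb')]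
            rw [show t / (t + (1 - t) * w 0) * pb = t * pb / (t + (1 - t) * w 0) by ring, mul_div_assoc', eq_div_iff hq']
            ring
          rw [e1, e2]; exact hn
  refine h10.trans (le_of_eq_of_le ?_ hmain)
  rw [hCst, ha, hε', hr]

end SharpMixing

end Summit.Ventures.LatticeQCDFlow.Scaling

end
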